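import Summits.AtomisticToContinuum.BoseEinsteinCondensation.Theorems.BECInsertionVarianceGroundStateAccessibleModulus
import Summits.AtomisticToContinuum.BoseEinsteinCondensation.Theorems.BECCutLineWeakDisorderGroundStateRigidityStubCompactness
import Literature.MathematicalPhysics.QuantumManyBody.GroundState
import Literature.MathematicalPhysics.QuantumManyBody.BoseGasThermodynamicLimitRuelle
import HarnessLib

/-!
# Existence of the nonnegative Dirichlet ground state (every pair potential with `E₀ < ∞`)

Helper for item `GroundStateAccessible` (stmt-AtomisticToContinuum-12069) of route `BECInsertionVariance`
(`Summit.AtomisticToContinuum.BoseEinsteinCondensation.Theses.BECInsertionVariance.GroundStateAccessible`):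
its EXISTENCE half in full generality — the child `GroundStateExists` foreseen by the route's two-layer
plan. `Literature/…/GroundState.lean` defines `IsGroundState` (normalised minimisers of the closed
Dirichlet form `closedEnergy`) and `groundState v N L` (classical choice of a NONNEGATIVE one, junk `0`
if none) and deliberately asserts no existence. Here:

* `exists_nonneg_isGroundState_of_ne_top` — **for every pair profile `v : ℝ → [0, ∞]` (hard cores
  allowed) and every box: if `E₀(N, L) = groundStateEnergy v N L < ∞` then a nonnegative ground state
  exists.** Proof: a minimising sequence of admissible trial states (definition of the infimum) is
  replaced by a NONNEGATIVE one (`exists_nonneg_trialState_energy_le`: normalised smoothed moduli,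
  the `C¹` diamagnetic inequality); its energies are bounded, so Rellich–Kondrachov on the box
  (`GroundStateRigidity.stub_compactness`, landed for crux stmt-AtomisticToContinuum-9072) extracts an
  `L²`-convergent subsequence with a measurable, Dirichlet, Bose-symmetric limit `Ψ`; the nonnegative
  representative `max (Re Ψ) 0` is still the `L²` limit (the projection onto `[0, ∞) ⊂ ℂ` is
  `1`-Lipschitz and fixes the approximants), and `IsGroundState.of_tendstoL2` (the closed form is the
  lower-semicontinuous envelope) concludes. Reed–Simon IV Thm XIII.47 / LSSY Ch. 7 ("the nonnegative
  normalised ground state"), existence part, with no assumption on `v` beyond `E₀ < ∞`.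
* `isGroundState_groundState_of_ne_top`, `lintegral_groundState_sq_of_ne_top` — so `groundState v N L`
  is in its good branch whenever `E₀ < ∞`.
* `eventually_groundStateEnergy_ne_top` — for a repulsive finite-range `v` of
  range `R`, at every density `ρ` with `ρ(1 + R)³ < 1` the energies `E₀(N, (N/ρ)^{1/3})` are eventually
  finite (Ruelle's cell bound `limsup_lt_top_of_small`), whence
* `eventually_exists_nonneg_isGroundState` / `eventually_isGroundState_groundState` — **GroundStateExists**: for every admissible `v` there is
  `ρ₀ > 0` such that for `0 < ρ < ρ₀` and all large `N` the nonnegative Dirichlet ground state in the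
  box of side `(N/ρ)^{1/3}` exists, and `groundState` is one (normalised).

What is NOT here: uniqueness / positivity / support of the ground state (the other half of the item).
-/

noncomputable section

open MeasureTheory Filter Set
open scoped ENNReal NNReal Topology

namespace Summit.AtomisticToContinuum.BoseEinsteinCondensation.Theorems.BECInsertionVariance

open Literature.MathematicalPhysics.QuantumManyBody.BoseGas
open Summit.AtomisticToContinuum.BoseEinsteinCondensation.Theorems.GroundStateRigidity (stub_compactness)

variable {N : ℕ}

/-- The projection of `ℂ` onto the nonnegative reals, `w ↦ max (Re w) 0`, is `1`-Lipschitz and fixes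
nonnegative reals: `‖z − max (Re w) 0‖ ≤ ‖z − w‖` when `z = |z|`. [folklore] -/
theorem norm_sub_ofReal_max_re_le {z w : ℂ} (hz : z = ((‖z‖ : ℝ) : ℂ)) :
    ‖z - ((max w.re 0 : ℝ) : ℂ)‖ ≤ ‖z - w‖ := by
  rw [hz, ← Complex.ofReal_sub, Complex.norm_real, Real.norm_eq_abs]
  have h1 : |‖z‖ - max w.re 0| ≤ |‖z‖ - w.re| := by
    have := abs_max_sub_max_le_abs ‖z‖ w.re 0
    rwa [max_eq_left (norm_nonneg z)] at this
  refine h1.trans ?_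
  have h2 : ‖z‖ - w.re = (((‖z‖ : ℝ) : ℂ) - w).re := by simp
  rw [h2]
  exact Complex.abs_re_le_norm _

/-- **Existence of a nonnegative ground state whenever `E₀ < ∞`.** For every pair profile `v`
(values in `[0, ∞]`, hard cores allowed), every `N` and `L`: if `groundStateEnergy v N L ≠ ⊤` then
there is `Ψ₀ ≥ 0` whose complexification is a ground state of the closed Dirichlet form
(`IsGroundState v L`). [cite: ReedSimonIV1978, §XIII.12 Thm XIII.47 and Thm XIII.64] -/
theorem exists_nonneg_isGroundState_of_ne_top {L : ℝ} {v : ℝ → ℝ≥0∞}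
    (hE : groundStateEnergy v N L ≠ ⊤) :
    ∃ Ψ₀ : Config N → ℝ, (∀ X, 0 ≤ Ψ₀ X) ∧ IsGroundState v L (fun X => (Ψ₀ X : ℂ)) := by
  set E₀ := groundStateEnergy v N L with hE₀
  -- a minimising sequence
  have hmin : ∀ k : ℕ, ∃ Φ : TrialState N L, energy v Φ ≤ E₀ + ENNReal.ofReal (1 / ((k : ℝ) + 1)) := by
    intro k
    have hpos : ENNReal.ofReal (1 / ((k : ℝ) + 1)) ≠ 0 :=
      (ENNReal.ofReal_pos.2 (by positivity)).ne'
    have hlt : E₀ < E₀ + ENNReal.ofReal (1 / ((k : ℝ) + 1)) := ENNReal.lt_add_right hE hpos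
    rw [hE₀, groundStateEnergy] at hlt
    obtain ⟨Φ, hΦ⟩ := iInf_lt_iff.1 hlt
    exact ⟨Φ, hΦ.le⟩
  choose Φ hΦ using hmin
  -- nonnegative near-minimisers, `δ_k = (1/2)·1/(k+1)`
  set δ : ℕ → ℝ := fun k => 1 / 2 * (1 / ((k : ℝ) + 1)) with hδdef
  have hδpos : ∀ k, 0 < δ k := fun k => by simp only [hδdef]; positivity
  have hδle : ∀ k, δ k ≤ 1 / 2 := fun k => by
    simp only [hδdef]
    have : 1 / ((k : ℝ) + 1) ≤ 1 := by rw [div_le_one (by positivity)]; linarith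
    linarith
  have hnn : ∀ k : ℕ, ∃ Φ' : TrialState N L, (∀ X, Φ'.ψ X = ((‖Φ'.ψ X‖ : ℝ) : ℂ)) ∧
      energy v Φ' ≤ (ENNReal.ofReal (1 - δ k))⁻¹ * energy v (Φ k) := fun k =>
    exists_nonneg_trialState_energy_le (Φ k) v (hδpos k) (by linarith [hδle k])
  choose Φ' hΦ'real hΦ'E using hnn
  -- a uniform energy bound
  have hinv2 : ∀ k, (ENNReal.ofReal (1 - δ k))⁻¹ ≤ 2 := fun k => by
    have h1 : ENNReal.ofReal (1 / 2) ≤ ENNReal.ofReal (1 - δ k) :=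
      ENNReal.ofReal_le_ofReal (by linarith [hδle k])
    calc (ENNReal.ofReal (1 - δ k))⁻¹ ≤ (ENNReal.ofReal (1 / 2))⁻¹ := ENNReal.inv_le_inv.2 h1
      _ = 2 := by
        rw [one_div, ENNReal.ofReal_inv_of_pos (by norm_num), inv_inv, ENNReal.ofReal_ofNat]
  have hE1 : E₀ + 1 ≠ ⊤ := ENNReal.add_ne_top.2 ⟨hE, ENNReal.one_ne_top⟩
  have hBtop : 2 * (E₀ + 1) ≠ ⊤ := ENNReal.mul_ne_top (by norm_num) hE1
  have hbound : ∀ k, energy v (Φ' k) ≤ 2 * (E₀ + 1) := fun k => by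
    refine (hΦ'E k).trans (mul_le_mul' (hinv2 k) ((hΦ k).trans (add_le_add le_rfl ?_)))
    exact ENNReal.ofReal_le_one.2 (by rw [div_le_one (by positivity)]; linarith)
  -- compactness (Rellich–Kondrachov on the box)
  obtain ⟨Ψ, φ, hφ, hΨm, hΨ0, hΨσ, hL2⟩ := stub_compactness N L v (2 * (E₀ + 1)) Φ' hBtop hbound
  -- the nonnegative representative
  set Ψ₀ : Config N → ℝ := fun X => max (Ψ X).re 0 with hΨ₀def
  have hΨ₀m : Measurable Ψ₀ := (Complex.measurable_re.comp hΨm).max measurable_const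
  have hL2' : TendstoL2 (fun k => Φ' (φ k)) (fun X => (Ψ₀ X : ℂ)) := by
    refine tendsto_of_tendsto_of_tendsto_of_le_of_le tendsto_const_nhds hL2 (fun _ => bot_le)
      fun k => lintegral_mono fun X => ?_
    have h := norm_sub_ofReal_max_re_le (w := Ψ X) (hΦ'real (φ k) X)
    have h' : (‖(Φ' (φ k)).ψ X - ((Ψ₀ X : ℝ) : ℂ)‖₊ : ℝ≥0∞) ≤ ‖(Φ' (φ k)).ψ X - Ψ X‖₊ := by
      exact_mod_cast h
    exact pow_le_pow_left' h' 2
  -- the energies along the subsequence tend to at most `E₀`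
  have hεlim : Tendsto (fun k : ℕ => 1 / ((k : ℝ) + 1)) atTop (𝓝 0) :=
    tendsto_one_div_add_atTop_nhds_zero_nat
  have ha : Tendsto (fun k : ℕ => (ENNReal.ofReal (1 - δ k))⁻¹ * (E₀ + ENNReal.ofReal (1 / ((k : ℝ) + 1))))
      atTop (𝓝 E₀) := by
    have h1 : Tendsto (fun k : ℕ => ENNReal.ofReal (1 - δ k)) atTop (𝓝 1) := by
      have hδ0 : Tendsto δ atTop (𝓝 0) := by
        have := hεlim.const_mul (1 / 2 : ℝ)
        rw [mul_zero] at this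
        exact this
      have h2 := ENNReal.tendsto_ofReal (tendsto_const_nhds.sub hδ0 (a := (1 : ℝ)))
      rwa [sub_zero, ENNReal.ofReal_one] at h2
    have h1' : Tendsto (fun k : ℕ => (ENNReal.ofReal (1 - δ k))⁻¹) atTop (𝓝 1) := by
      have := h1.inv
      rwa [inv_one] at this
    have h3 : Tendsto (fun k : ℕ => E₀ + ENNReal.ofReal (1 / ((k : ℝ) + 1))) atTop (𝓝 E₀) := by
      have h4 := ENNReal.tendsto_ofReal hεlim
      rw [ENNReal.ofReal_zero] at h4
      have := h4.const_add E₀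
      rwa [add_zero] at this
    have := ENNReal.Tendsto.mul h1' (Or.inl one_ne_zero) h3 (Or.inr ENNReal.one_ne_top)
    rwa [one_mul] at this
  have hlim : liminf (fun k => energy v (Φ' (φ k))) atTop ≤ E₀ := by
    calc liminf (fun k => energy v (Φ' (φ k))) atTop
        ≤ liminf (fun k => (ENNReal.ofReal (1 - δ (φ k)))⁻¹ *
            (E₀ + ENNReal.ofReal (1 / (((φ k : ℕ) : ℝ) + 1)))) atTop :=
          liminf_le_liminf (Eventually.of_forall fun k =>
            (hΦ'E (φ k)).trans (mul_le_mul' le_rfl (hΦ (φ k))))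
      _ = E₀ := (ha.comp hφ.tendsto_atTop).liminf_eq
  -- conclude
  refine ⟨Ψ₀, fun X => le_max_right _ _, ?_⟩
  exact IsGroundState.of_tendstoL2 (Complex.measurable_ofReal.comp hΨ₀m)
    (fun X hX => by simp [hΨ₀def, hΨ0 X hX]) (fun σ X => by simp [hΨ₀def, hΨσ σ X]) hE hL2' hlim

/-- Whenever `E₀(N, L) < ∞` the library's `groundState v N L` is a genuine ground state (good branch
of the classical choice), for every pair profile `v`. [cite: LSSY2005, §1.2 (1.17) and Ch. 7] -/
theorem isGroundState_groundState_of_ne_top {L : ℝ} {v : ℝ → ℝ≥0∞}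
    (hE : groundStateEnergy v N L ≠ ⊤) :
    IsGroundState v L (fun X => (groundState v N L X : ℂ)) :=
  isGroundState_groundState (exists_nonneg_isGroundState_of_ne_top hE)

/-- Whenever `E₀(N, L) < ∞` the library's `groundState v N L` is normalised, `∫ Ψ₀² = 1`.
[cite: LSSY2005, §1.2 (1.17)] -/
theorem lintegral_groundState_sq_of_ne_top {L : ℝ} {v : ℝ → ℝ≥0∞}
    (hE : groundStateEnergy v N L ≠ ⊤) :
    ∫⁻ X, ENNReal.ofReal (groundState v N L X) ^ 2 = 1 :=
  lintegral_groundState_sq (exists_nonneg_isGroundState_of_ne_top hE)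

/-- Conversely, `E₀(N, L) < ∞` is necessary: if a (nonnegative) ground state exists the energy is
finite; so existence of the nonnegative ground state is EQUIVALENT to `groundStateEnergy v N L ≠ ⊤`.
[folklore] -/
theorem exists_nonneg_isGroundState_iff {L : ℝ} {v : ℝ → ℝ≥0∞} :
    (∃ Ψ₀ : Config N → ℝ, (∀ X, 0 ≤ Ψ₀ X) ∧ IsGroundState v L (fun X => (Ψ₀ X : ℂ))) ↔
      groundStateEnergy v N L ≠ ⊤ :=
  ⟨fun ⟨_, _, h⟩ => h.groundStateEnergy_ne_top, exists_nonneg_isGroundState_of_ne_top⟩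

/-! ### Along the thermodynamic box sequence: admissible potentials at low density -/

/-- **Eventual finiteness of the Dirichlet energy at low density.** For a repulsive finite-range `v`
there is `ρ₀ > 0` such that for `0 < ρ < ρ₀` the energies `E₀(N, (N/ρ)^{1/3})` are finite for all
large `N` (Ruelle's cell construction: `limsup_N E₀/N < ∞` below the close-packing threshold
`ρ(1 + R)³ < 1`). [cite: Ruelle1969, §3.5.11] -/
theorem eventually_groundStateEnergy_ne_top {v : ℝ → ℝ≥0∞}
    (hv : IsRepulsiveFiniteRange v) :
    ∃ ρ₀ : ℝ, 0 < ρ₀ ∧ ∀ ρ : ℝ, 0 < ρ → ρ < ρ₀ → ∀ᶠ N : ℕ in atTop,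
      groundStateEnergy v N (sideLength ρ N) ≠ ⊤ := by
  obtain ⟨R, hR, hv0⟩ := hv.exists_pos_range
  refine ⟨1 / (1 + R) ^ 3, by positivity, fun ρ hρ hρlt => ?_⟩
  have hsmall : ρ * (1 + R) ^ 3 < 1 := by
    rwa [lt_div_iff₀ (by positivity)] at hρlt
  have hlim : limsup (energyPerParticleDirichlet v ρ) atTop < ⊤ :=
    limsup_lt_top_of_small hv.1 hv0 hR hρ hsmall
  filter_upwards [Filter.eventually_lt_of_limsup_lt hlim, eventually_ge_atTop 1] with N hN hN1 htop
  refine hN.ne ?_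
  rw [energyPerParticleDirichlet, htop, ENNReal.top_div_of_ne_top (ENNReal.natCast_ne_top N)]

/-- **GroundStateExists.** For every repulsive finite-range pair potential there is `ρ₀ > 0` such
that for `0 < ρ < ρ₀` and all large `N` the `N`-boson Dirichlet problem in the box of side
`(N/ρ)^{1/3}` has a nonnegative ground state. [cite: ReedSimonIV1978, §XIII.12 Thm XIII.47] -/
theorem eventually_exists_nonneg_isGroundState {v : ℝ → ℝ≥0∞}
    (hv : IsRepulsiveFiniteRange v) :
    ∃ ρ₀ : ℝ, 0 < ρ₀ ∧ ∀ ρ : ℝ, 0 < ρ → ρ < ρ₀ → ∀ᶠ N : ℕ in atTop,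
      ∃ Ψ₀ : Config N → ℝ, (∀ X, 0 ≤ Ψ₀ X) ∧
        IsGroundState v (sideLength ρ N) (fun X => (Ψ₀ X : ℂ)) := by
  obtain ⟨ρ₀, hρ₀, h⟩ := eventually_groundStateEnergy_ne_top hv
  refine ⟨ρ₀, hρ₀, fun ρ hρ hρlt => ?_⟩
  filter_upwards [h ρ hρ hρlt] with N hN
  exact exists_nonneg_isGroundState_of_ne_top hN

/-- Along the thermodynamic box sequence at low density, `groundState` is eventually a normalised
ground state (not the junk `0`), for every admissible `v`. [cite: LSSY2005, §1.2 (1.17) and Ch. 7] -/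
theorem eventually_isGroundState_groundState {v : ℝ → ℝ≥0∞}
    (hv : IsRepulsiveFiniteRange v) :
    ∃ ρ₀ : ℝ, 0 < ρ₀ ∧ ∀ ρ : ℝ, 0 < ρ → ρ < ρ₀ → ∀ᶠ N : ℕ in atTop,
      IsGroundState v (sideLength ρ N) (fun X => (groundState v N (sideLength ρ N) X : ℂ)) ∧
        ∫⁻ X, ENNReal.ofReal (groundState v N (sideLength ρ N) X) ^ 2 = 1 := by
  obtain ⟨ρ₀, hρ₀, h⟩ := eventually_groundStateEnergy_ne_top hv
  refine ⟨ρ₀, hρ₀, fun ρ hρ hρlt => ?_⟩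
  filter_upwards [h ρ hρ hρlt] with N hN
  exact ⟨isGroundState_groundState_of_ne_top hN, lintegral_groundState_sq_of_ne_top hN⟩

end Summit.AtomisticToContinuum.BoseEinsteinCondensation.Theorems.BECInsertionVariance

end
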